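import Literature.MathematicalPhysics.QuantumFieldTheory.Federbush1986.AbelianEstimatesLe

/-!
# `Federbush1986.GaugeTransformDecay` — [Federbush1986PhaseCellI] (3.2) p. 327 and §4 p. 329: the gauge transform
# `A_μ = A^N_μ + ∂_μΛ` has the same field strength and the same continuum action, so «A_μ(x) minimizes the continuum action
# subject to the constraint of bond assignments at level 0», and «Clearly A_μ(x) given by (3.2) satisfies the bounds in
# (3.13)–(3.15)» when `|D^αΛ| < c_αe^{−γ|x|}` — PROVED

statement-level skeleton of published theorems with citation tags; proofs where landed; nothing here is a claim about the Yang–Mills mass gap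

CITATION HEADER.  P. Federbush, *A phase cell approach to Yang–Mills theory. I*, Commun. Math. Phys. **107** (1986) 319–329
[Federbush1986PhaseCellI] (renders `run/shared/lean/pub/lit-balaban/lit-balaban-r17/renders/fedI/fed1986-cmp107-p009-x2.png`,
`-p011-x2.png`, re-read as images).  p. 327, verbatim: *«A_μ(x) will be a gauge transformation of A^N_μ(x), A_μ(x) = A^N_μ(x) +
∂_μΛ. (3.2)  From this it easily follows A_μ(x) minimizes the continuum action subject to the constraint of bond assignments
at level 0.»*; p. 329: *«We now find Λ(x) in C^∞(R⁴) satisfying Λ(x) = h(x), x ∈ Z⁴, (4.5) and |D^αΛ(x)| < c_αe^{−γ|x|}, (4.6)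
… We let this be the Λ(x) of (3.2).  Clearly A_μ(x) given by (3.2) satisfies the bounds in (3.13)–(3.15).»*; (3.13)–(3.15)
p. 328 (typed `AbelianAveraging.Decay313to315`, p239224).  Unit `lit-balaban-p04` gen 6; SKELETON rows **F1.Eq3.2-3.12**
(absent: proof-internal; this file types and proves (3.2) and its two «easily follows / clearly» sentences) and F1.Eq4.1-4.6
of `run/shared/lean/pub/lit-balaban/lit-balaban-r17/SKELETON-r17.md` (fold owner r17); companions `SmoothGaugeInterpolation`
((4.5)–(4.6): the `Λ`), `LatticeGaugeFunction` ((4.3)–(4.4)).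

THE MATHEMATICS.  `gaugeTransform A^N Λ := (x, μ) ↦ A^N_μ(x) + dΛ(x)·u_μ` (3.2).  For `A^N ∈ C¹`, `Λ ∈ C^∞`:
(i) `∂_ν(A^N_μ + ∂_μΛ) = ∂_νA^N_μ + D²Λ(x)(u_ν, u_μ)` (`pd_gaugeTransform`), so by the symmetry of second derivatives
(Schwarz, Mathlib `ContDiffAt.isSymmSndFDerivAt`) the field strength `∂_μA_ν − ∂_νA_μ` and hence the continuum action are
unchanged (`fieldStrength_gaugeTransform`, **`contAction_gaugeTransform`**) — whence the p. 327 sentence in the abstract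
form **`isConstrainedMinimizer_gaugeTransform`**: if `A^N` minimises the action among `C¹` fields with ITS level-0
plaquette assignments, and `A = A^N + dΛ` has level-0 bond assignments `a` and the same plaquette assignments as `A^N`, then
`A` minimises among the fields with bond assignments `a` (plaquette values are a function of bond values).  (ii) With
`‖D^kΛ(x)‖ ≤ C_k e^{−γ'|x|}` (`k = 1, 2, 3`) and (3.13)–(3.15) for `A^N` with rate `γ₁`: `|A_μ| < (c + C₁ + C₂ + 1)e^{−γ|x|}`,
`|DA_μ| < (…)e^{−γ|x|}` with `γ = min(γ₁, γ')`, and for the Hölder quotient of `DA_μ` at `|x − y| < 1` the mean value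
inequality on the ball `B(x,1)` applied to `z ↦ D²Λ(z)(u_ν,u_μ)` (derivative bounded by `‖D³Λ‖ ≤ C₃e^{γ'}e^{−γ'|x|}` there)
gives `|x−y|^{ε}C₃e^{γ'}e^{−γ'|x|} ≤ C₃e^{γ'}e^{−γ'|x|}`: **`decay313to315_gaugeTransform`** — the p. 329 sentence.

WHAT THIS MODULE PROVIDES.  Def `gaugeTransform` ((3.2), body); `contDiff_gaugeTransform`, `pd_gaugeTransform`,
`fieldStrength_gaugeTransform`, `contAction_gaugeTransform`, `isConstrainedMinimizer_gaugeTransform` (p. 327),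
`decay313to315_gaugeTransform` and the wrapper `decay313to315_gaugeTransform'` taking the (4.6)-shaped family of bounds
(p. 329).  No new `Prop` fact; axioms standard.
-/

namespace Literature.MathematicalPhysics.QuantumFieldTheory.Federbush1986

open Filter Set Metric
open scoped ContDiff

noncomputable section

namespace AbelianAveraging

/-- **(3.2)** «A_μ(x) = A^N_μ(x) + ∂_μΛ»: the gauge transform of a potential by `Λ`. [cite: Federbush1986PhaseCellI, (3.2)
p. 327] -/
def gaugeTransform (AN : E4 → Fin 4 → ℝ) (Λ : E4 → ℝ) : E4 → Fin 4 → ℝ := fun x μ => AN x μ + fderiv ℝ Λ x (unitVec μ)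

/-- `‖u_μ‖ = 1`. [folklore] -/
private theorem norm_unitVec₆ (μ : Fin 4) : ‖(unitVec μ : E4)‖ = 1 := by
  unfold unitVec; simp

variable {AN : E4 → Fin 4 → ℝ} {Λ : E4 → ℝ}

/-- `Λ ∈ C^∞ ⇒ Λ ∈ C³` (the regularity used below). [folklore] -/
private theorem contDiff_three (hΛ : ContDiff ℝ ∞ Λ) : ContDiff ℝ 3 Λ := contDiff_infty.1 hΛ 3

/-- `dΛ` is `C²`. [cite: Federbush1986PhaseCellI, (3.2) p. 327] -/
theorem contDiff_fderiv_two (hΛ : ContDiff ℝ ∞ Λ) : ContDiff ℝ 2 (fderiv ℝ Λ) :=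
  (contDiff_three hΛ).fderiv_right (by norm_num)

/-- The gauge transform of a `C¹` potential by a smooth `Λ` is `C¹`. [cite: Federbush1986PhaseCellI, (3.2) p. 327] -/
theorem contDiff_gaugeTransform (hAN : ContDiff ℝ 1 AN) (hΛ : ContDiff ℝ ∞ Λ) : ContDiff ℝ 1 (gaugeTransform AN Λ) := by
  have h1 : ContDiff ℝ 1 (fderiv ℝ Λ) := (contDiff_fderiv_two hΛ).of_le (by norm_num)
  have h2 : ContDiff ℝ 1 fun x : E4 => fun μ : Fin 4 => fderiv ℝ Λ x (unitVec μ) :=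
    contDiff_pi.2 fun μ => h1.clm_apply contDiff_const
  exact hAN.add h2

/-- `∂_ν(A^N_μ + ∂_μΛ)(x) = ∂_νA^N_μ(x) + D²Λ(x)(u_ν, u_μ)`. [cite: Federbush1986PhaseCellI, (3.2) p. 327] -/
theorem pd_gaugeTransform (hAN : ContDiff ℝ 1 AN) (hΛ : ContDiff ℝ ∞ Λ) (ν μ : Fin 4) (x : E4) :
    pd (gaugeTransform AN Λ) ν μ x = pd AN ν μ x + iteratedFDeriv ℝ 2 Λ x ![unitVec ν, unitVec μ] := by
  have hdA : DifferentiableAt ℝ (fun y => AN y μ) x :=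
    ((contDiff_pi.1 hAN μ).differentiable one_ne_zero).differentiableAt
  have hdF : DifferentiableAt ℝ (fderiv ℝ Λ) x :=
    ((contDiff_fderiv_two hΛ).differentiable two_ne_zero).differentiableAt
  have hdL : DifferentiableAt ℝ (fun y => fderiv ℝ Λ y (unitVec μ)) x := hdF.clm_apply (differentiableAt_const _)
  unfold pd gaugeTransform
  rw [fderiv_fun_add hdA hdL, add_apply, fderiv_clm_apply hdF (differentiableAt_const _),
    fderiv_const_apply, iteratedFDeriv_two_apply]
  simp

/-- **Gauge invariance of the field strength**: `∂_μA_ν − ∂_νA_μ` is unchanged under (3.2) (symmetry of `D²Λ`).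
[cite: Federbush1986PhaseCellI, (3.2) p. 327, §0 p. 319–320] -/
theorem fieldStrength_gaugeTransform (hAN : ContDiff ℝ 1 AN) (hΛ : ContDiff ℝ ∞ Λ) (μ ν : Fin 4) (x : E4) :
    pd (gaugeTransform AN Λ) μ ν x - pd (gaugeTransform AN Λ) ν μ x = pd AN μ ν x - pd AN ν μ x := by
  have hs : IsSymmSndFDerivAt ℝ Λ x := ((contDiff_infty.1 hΛ 2).contDiffAt (x := x)).isSymmSndFDerivAt (by simp)
  rw [pd_gaugeTransform hAN hΛ, pd_gaugeTransform hAN hΛ, iteratedFDeriv_two_apply, iteratedFDeriv_two_apply]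
  simp only [Matrix.cons_val_zero, Matrix.cons_val_one]
  rw [hs (unitVec μ) (unitVec ν)]
  ring

/-- **Gauge invariance of the continuum action** under (3.2). [cite: Federbush1986PhaseCellI, (3.2) p. 327 («From this it
easily follows A_μ(x) minimizes the continuum action …»)] -/
theorem contAction_gaugeTransform (hAN : ContDiff ℝ 1 AN) (hΛ : ContDiff ℝ ∞ Λ) :
    contAction (gaugeTransform AN Λ) = contAction AN := by
  unfold contAction
  congr 1
  funext x
  congr 1
  refine Finset.sum_congr rfl fun μ _ => Finset.sum_congr rfl fun ν _ => ?_
  rw [fieldStrength_gaugeTransform hAN hΛ]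

/-- **p. 327: «From this it easily follows A_μ(x) minimizes the continuum action subject to the constraint of bond assignments
at level 0.»**  Abstract form: `A^N` minimises among `C¹` fields with its level-0 PLAQUETTE assignments; `A = A^N + dΛ` has the
same action, level-0 bond assignments `a`, and the same plaquettes as `A^N` (hypothesis `hplaq` — in print because
`A(e) − A^N(e) = h(b) − h(a)`); plaquette values being a function of bond values, `A` minimises among the fields with bond
assignments `a`. [cite: Federbush1986PhaseCellI, (3.2) p. 327] -/
theorem isConstrainedMinimizer_gaugeTransform (D : AbelianAveraging) (hAN : ContDiff ℝ 1 AN) (hΛ : ContDiff ℝ ∞ Λ)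
    {a : Edge 0 → ℝ} (hbond : D.bond 0 (gaugeTransform AN Λ) = a)
    (hplaq : ∀ p : Plaq 0, D.plaq 0 (gaugeTransform AN Λ) p = D.plaq 0 AN p)
    (hmin : ∀ A' : E4 → Fin 4 → ℝ, ContDiff ℝ 1 A' → (∀ p : Plaq 0, D.plaq 0 A' p = D.plaq 0 AN p) →
      contAction AN ≤ contAction A') :
    D.IsConstrainedMinimizer 0 a (gaugeTransform AN Λ) := by
  refine ⟨contDiff_gaugeTransform hAN hΛ, hbond, fun A' hA' hb' => ?_⟩
  rw [contAction_gaugeTransform hAN hΛ]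
  refine hmin A' hA' fun p => ?_
  rw [← hplaq p]
  unfold plaq
  rw [hb', hbond]

/-! ## The decay package (3.13)–(3.15) is preserved -/

/-- A bound `‖F y‖ ≤ C e^{−γ|y|}` has `C ≥ 0`. [folklore] -/
private theorem const_nonneg_of_bound {F : E4 → ℝ} {C γ : ℝ} (h : ∀ y : E4, F y ≤ C * Real.exp (-γ * ‖y‖))
    (h0 : 0 ≤ F 0) : 0 ≤ C := by
  have := h0.trans (h 0)
  simpa using this

/-- `|dΛ(x)·u_μ| ≤ ‖DΛ(x)‖ = ‖D¹Λ(x)‖`. [cite: Federbush1986PhaseCellI, (4.6) p. 329] -/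
theorem abs_fderiv_unitVec_le (Λ : E4 → ℝ) (x : E4) (μ : Fin 4) :
    |fderiv ℝ Λ x (unitVec μ)| ≤ ‖iteratedFDeriv ℝ 1 Λ x‖ := by
  rw [← Real.norm_eq_abs, norm_iteratedFDeriv_one]
  simpa [norm_unitVec₆] using (fderiv ℝ Λ x).le_opNorm (unitVec μ)

/-- `|D²Λ(x)(u_ν,u_μ)| ≤ ‖D²Λ(x)‖`. [cite: Federbush1986PhaseCellI, (4.6) p. 329] -/
theorem abs_iteratedFDeriv_two_le (Λ : E4 → ℝ) (x : E4) (ν μ : Fin 4) :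
    |iteratedFDeriv ℝ 2 Λ x ![unitVec ν, unitVec μ]| ≤ ‖iteratedFDeriv ℝ 2 Λ x‖ := by
  rw [← Real.norm_eq_abs]
  have := (iteratedFDeriv ℝ 2 Λ x).le_opNorm ![unitVec ν, unitVec μ]
  simpa [Fin.prod_univ_two, norm_unitVec₆] using this

/-- The Hölder-type bound for `z ↦ D²Λ(z)(u_ν,u_μ)` from `‖D³Λ‖ ≤ C₃e^{−γ'|z|}` on the unit ball about `x` (mean value
inequality): `|D²Λ(x)(u_ν,u_μ) − D²Λ(y)(u_ν,u_μ)| ≤ C₃e^{γ'}e^{−γ'|x|}|x − y|` for `|x − y| < 1`.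
[cite: Federbush1986PhaseCellI, (3.15) p. 328, (4.6) p. 329] -/
theorem abs_sub_iteratedFDeriv_two_le (hΛ : ContDiff ℝ ∞ Λ) {C₃ γ' : ℝ} (hγ' : 0 ≤ γ')
    (h3 : ∀ y, ‖iteratedFDeriv ℝ 3 Λ y‖ ≤ C₃ * Real.exp (-γ' * ‖y‖)) (ν μ : Fin 4) {x y : E4} (hd : dist x y < 1) :
    |iteratedFDeriv ℝ 2 Λ x ![unitVec ν, unitVec μ] - iteratedFDeriv ℝ 2 Λ y ![unitVec ν, unitVec μ]|
      ≤ C₃ * Real.exp γ' * Real.exp (-γ' * ‖x‖) * dist x y := by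
  have hC₃ : 0 ≤ C₃ := const_nonneg_of_bound h3 (norm_nonneg _)
  set m : Fin 2 → E4 := ![unitVec ν, unitVec μ] with hm
  have hm1 : ∏ i, ‖m i‖ = 1 := by simp [hm, Fin.prod_univ_two, norm_unitVec₆]
  have hdiff : Differentiable ℝ (iteratedFDeriv ℝ 2 Λ) := (contDiff_three hΛ).differentiable_iteratedFDeriv (by norm_num)
  have hg : ∀ z ∈ ball x 1, DifferentiableAt ℝ (fun z => iteratedFDeriv ℝ 2 Λ z m) z :=
    fun z _ => (hdiff z).continuousMultilinear_apply_const m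
  have hbound : ∀ z ∈ ball x 1, ‖fderiv ℝ (fun z => iteratedFDeriv ℝ 2 Λ z m) z‖ ≤ C₃ * Real.exp γ' * Real.exp (-γ' * ‖x‖) := by
    intro z hz
    have hK0 : 0 ≤ C₃ * Real.exp γ' * Real.exp (-γ' * ‖x‖) := by positivity
    refine ContinuousLinearMap.opNorm_le_bound _ hK0 fun w => ?_
    rw [fderiv_continuousMultilinear_apply_const_apply (hdiff z) m w]
    have h1 : ‖(fderiv ℝ (iteratedFDeriv ℝ 2 Λ) z w) m‖ ≤ ‖fderiv ℝ (iteratedFDeriv ℝ 2 Λ) z w‖ * ∏ i, ‖m i‖ :=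
      (fderiv ℝ (iteratedFDeriv ℝ 2 Λ) z w).le_opNorm m
    have h2 : ‖fderiv ℝ (iteratedFDeriv ℝ 2 Λ) z w‖ ≤ ‖iteratedFDeriv ℝ 3 Λ z‖ * ‖w‖ := by
      rw [← norm_fderiv_iteratedFDeriv]; exact (fderiv ℝ (iteratedFDeriv ℝ 2 Λ) z).le_opNorm w
    have h3z : ‖iteratedFDeriv ℝ 3 Λ z‖ ≤ C₃ * Real.exp γ' * Real.exp (-γ' * ‖x‖) := by
      refine (h3 z).trans ?_
      rw [mul_assoc, ← Real.exp_add]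
      refine mul_le_mul_of_nonneg_left (Real.exp_le_exp.2 ?_) hC₃
      have hz' : dist z x < 1 := mem_ball.1 hz
      have : ‖x‖ ≤ ‖z‖ + dist z x := by
        have := norm_le_norm_add_norm_sub' x z  -- ‖x‖ ≤ ‖z‖ + ‖x - z‖
        rwa [← dist_eq_norm, dist_comm] at this
      nlinarith
    rw [hm1, mul_one] at h1
    calc ‖(fderiv ℝ (iteratedFDeriv ℝ 2 Λ) z w) m‖ ≤ ‖fderiv ℝ (iteratedFDeriv ℝ 2 Λ) z w‖ := h1
      _ ≤ ‖iteratedFDeriv ℝ 3 Λ z‖ * ‖w‖ := h2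
      _ ≤ C₃ * Real.exp γ' * Real.exp (-γ' * ‖x‖) * ‖w‖ := mul_le_mul_of_nonneg_right h3z (norm_nonneg _)
  have hmv := (convex_ball x 1).norm_image_sub_le_of_norm_fderiv_le hg hbound (mem_ball_self one_pos)
    (mem_ball.2 (by rwa [dist_comm] at hd))
  rw [Real.norm_eq_abs, abs_sub_comm, ← dist_eq_norm, dist_comm] at hmv
  exact hmv

/-- **p. 329: «Clearly A_μ(x) given by (3.2) satisfies the bounds in (3.13)–(3.15).»**  If `A^N` has the decay package
(3.13)–(3.15) and `Λ ∈ C^∞` obeys (4.6) for `|α| = 1, 2, 3` with rate `γ'`, then `A^N + dΛ` has the package (3.13)–(3.15)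
(rate `min(γ, γ')`, constants `c + C₁ + C₂ + 1` and `c_ε + C₃e^{γ'}`). [cite: Federbush1986PhaseCellI, §4 p. 329; (3.2)
p. 327; (3.13)–(3.15) p. 328] -/
theorem decay313to315_gaugeTransform (hAN : Decay313to315 AN) (hΛ : ContDiff ℝ ∞ Λ) {γ' C₁ C₂ C₃ : ℝ} (hγ' : 0 < γ')
    (h1 : ∀ y, ‖iteratedFDeriv ℝ 1 Λ y‖ ≤ C₁ * Real.exp (-γ' * ‖y‖))
    (h2 : ∀ y, ‖iteratedFDeriv ℝ 2 Λ y‖ ≤ C₂ * Real.exp (-γ' * ‖y‖))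
    (h3 : ∀ y, ‖iteratedFDeriv ℝ 3 Λ y‖ ≤ C₃ * Real.exp (-γ' * ‖y‖)) :
    Decay313to315 (gaugeTransform AN Λ) := by
  obtain ⟨c, hc, γ₁, hγ₁, cε, hC1, h13, h14, h15⟩ := hAN
  have hC₁ : 0 ≤ C₁ := const_nonneg_of_bound h1 (norm_nonneg _)
  have hC₂ : 0 ≤ C₂ := const_nonneg_of_bound h2 (norm_nonneg _)
  have hC₃ : 0 ≤ C₃ := const_nonneg_of_bound h3 (norm_nonneg _)
  have hγ : 0 < min γ₁ γ' := lt_min hγ₁ hγ'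
  have hexp₁ : ∀ y : E4, Real.exp (-γ₁ * ‖y‖) ≤ Real.exp (-(min γ₁ γ') * ‖y‖) := fun y =>
    Real.exp_le_exp.2 (by nlinarith [norm_nonneg y, min_le_left γ₁ γ'])
  have hexp' : ∀ y : E4, Real.exp (-γ' * ‖y‖) ≤ Real.exp (-(min γ₁ γ') * ‖y‖) := fun y =>
    Real.exp_le_exp.2 (by nlinarith [norm_nonneg y, min_le_right γ₁ γ'])
  refine ⟨c + C₁ + C₂ + 1, by positivity, min γ₁ γ', hγ, fun ε => cε ε + C₃ * Real.exp γ',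
    contDiff_gaugeTransform hC1 hΛ, ?_, ?_, ?_⟩
  · -- (3.13)
    intro x μ
    have hb := (abs_fderiv_unitVec_le Λ x μ).trans (h1 x)
    have hpos := Real.exp_pos (-(min γ₁ γ') * ‖x‖)
    calc |gaugeTransform AN Λ x μ| ≤ |AN x μ| + |fderiv ℝ Λ x (unitVec μ)| := abs_add_le _ _
      _ < c * Real.exp (-γ₁ * ‖x‖) + C₁ * Real.exp (-γ' * ‖x‖) := add_lt_add_of_lt_of_le (h13 x μ) hb
      _ ≤ c * Real.exp (-(min γ₁ γ') * ‖x‖) + C₁ * Real.exp (-(min γ₁ γ') * ‖x‖) :=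
          add_le_add (mul_le_mul_of_nonneg_left (hexp₁ x) hc.le) (mul_le_mul_of_nonneg_left (hexp' x) hC₁)
      _ ≤ (c + C₁ + C₂ + 1) * Real.exp (-(min γ₁ γ') * ‖x‖) := by nlinarith
  · -- (3.14)
    intro x ν μ
    rw [pd_gaugeTransform hC1 hΛ]
    have hb := (abs_iteratedFDeriv_two_le Λ x ν μ).trans (h2 x)
    have hpos := Real.exp_pos (-(min γ₁ γ') * ‖x‖)
    calc |pd AN ν μ x + iteratedFDeriv ℝ 2 Λ x ![unitVec ν, unitVec μ]|
        ≤ |pd AN ν μ x| + |iteratedFDeriv ℝ 2 Λ x ![unitVec ν, unitVec μ]| := abs_add_le _ _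
      _ < c * Real.exp (-γ₁ * ‖x‖) + C₂ * Real.exp (-γ' * ‖x‖) := add_lt_add_of_lt_of_le (h14 x ν μ) hb
      _ ≤ c * Real.exp (-(min γ₁ γ') * ‖x‖) + C₂ * Real.exp (-(min γ₁ γ') * ‖x‖) :=
          add_le_add (mul_le_mul_of_nonneg_left (hexp₁ x) hc.le) (mul_le_mul_of_nonneg_left (hexp' x) hC₂)
      _ ≤ (c + C₁ + C₂ + 1) * Real.exp (-(min γ₁ γ') * ‖x‖) := by nlinarith
  · -- (3.15)
    intro ε hε x y ν μ hxy hd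
    rw [pd_gaugeTransform hC1 hΛ, pd_gaugeTransform hC1 hΛ]
    have hdpos : 0 < dist x y := dist_pos.2 hxy
    have hdε : 0 < dist x y ^ (1 - ε) := Real.rpow_pos_of_pos hdpos _
    have hq15 := h15 ε hε x y ν μ hxy hd
    -- `c_ε > 0` at this `ε`: the printed quotient is non-negative and strictly below `c_ε e^{−γ₁|x|}`
    have hcε : 0 < cε ε := by
      have h0 : 0 ≤ |pd AN ν μ x - pd AN ν μ y| / dist x y ^ (1 - ε) := div_nonneg (abs_nonneg _) hdε.le
      have h1' : 0 < cε ε * Real.exp (-γ₁ * ‖x‖) := h0.trans_lt hq15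
      by_contra hn
      rw [not_lt] at hn
      nlinarith [Real.exp_pos (-γ₁ * ‖x‖)]
    -- the `Λ`-part of the Hölder quotient
    have hK : 0 ≤ C₃ * Real.exp γ' * Real.exp (-γ' * ‖x‖) := by positivity
    have hΛq : |iteratedFDeriv ℝ 2 Λ x ![unitVec ν, unitVec μ] - iteratedFDeriv ℝ 2 Λ y ![unitVec ν, unitVec μ]|
        / dist x y ^ (1 - ε) ≤ C₃ * Real.exp γ' * Real.exp (-γ' * ‖x‖) := by
      rw [div_le_iff₀ hdε]
      have hdle : dist x y ≤ dist x y ^ (1 - ε) := by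
        have := Real.rpow_le_rpow_of_exponent_ge hdpos hd.le (by linarith : 1 - ε ≤ 1)
        rwa [Real.rpow_one] at this
      exact (abs_sub_iteratedFDeriv_two_le hΛ hγ'.le h3 ν μ hd).trans (mul_le_mul_of_nonneg_left hdle hK)
    have hpos := Real.exp_pos (-(min γ₁ γ') * ‖x‖)
    rw [show pd AN ν μ x + iteratedFDeriv ℝ 2 Λ x ![unitVec ν, unitVec μ]
        - (pd AN ν μ y + iteratedFDeriv ℝ 2 Λ y ![unitVec ν, unitVec μ])
        = (pd AN ν μ x - pd AN ν μ y)
          + (iteratedFDeriv ℝ 2 Λ x ![unitVec ν, unitVec μ] - iteratedFDeriv ℝ 2 Λ y ![unitVec ν, unitVec μ]) by ring]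
    calc |(pd AN ν μ x - pd AN ν μ y)
            + (iteratedFDeriv ℝ 2 Λ x ![unitVec ν, unitVec μ] - iteratedFDeriv ℝ 2 Λ y ![unitVec ν, unitVec μ])|
          / dist x y ^ (1 - ε)
        ≤ (|pd AN ν μ x - pd AN ν μ y|
            + |iteratedFDeriv ℝ 2 Λ x ![unitVec ν, unitVec μ] - iteratedFDeriv ℝ 2 Λ y ![unitVec ν, unitVec μ]|)
            / dist x y ^ (1 - ε) := div_le_div_of_nonneg_right (abs_add_le _ _) hdε.le
      _ = |pd AN ν μ x - pd AN ν μ y| / dist x y ^ (1 - ε)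
            + |iteratedFDeriv ℝ 2 Λ x ![unitVec ν, unitVec μ] - iteratedFDeriv ℝ 2 Λ y ![unitVec ν, unitVec μ]|
              / dist x y ^ (1 - ε) := add_div _ _ _
      _ < cε ε * Real.exp (-γ₁ * ‖x‖) + C₃ * Real.exp γ' * Real.exp (-γ' * ‖x‖) := add_lt_add_of_lt_of_le hq15 hΛq
      _ ≤ cε ε * Real.exp (-(min γ₁ γ') * ‖x‖) + C₃ * Real.exp γ' * Real.exp (-(min γ₁ γ') * ‖x‖) :=
          add_le_add (mul_le_mul_of_nonneg_left (hexp₁ x) hcε.le) (mul_le_mul_of_nonneg_left (hexp' x) (by positivity))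
      _ = (cε ε + C₃ * Real.exp γ') * Real.exp (-(min γ₁ γ') * ‖x‖) := by ring

/-- The same with the (4.6)-shaped family of bounds produced by `SmoothGaugeInterpolation.exists_smooth_interpolation`
(`∀ k, ∃ C_k, ‖D^kΛ(y)‖ ≤ C_k e^{−γ'|y|}`). [cite: Federbush1986PhaseCellI, §4 p. 329] -/
theorem decay313to315_gaugeTransform' (hAN : Decay313to315 AN) (hΛ : ContDiff ℝ ∞ Λ) {γ' : ℝ} (hγ' : 0 < γ')
    (hD : ∀ k : ℕ, ∃ C : ℝ, ∀ y : E4, ‖iteratedFDeriv ℝ k Λ y‖ ≤ C * Real.exp (-γ' * ‖y‖)) :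
    Decay313to315 (gaugeTransform AN Λ) := by
  obtain ⟨C₁, h1⟩ := hD 1
  obtain ⟨C₂, h2⟩ := hD 2
  obtain ⟨C₃, h3⟩ := hD 3
  exact decay313to315_gaugeTransform hAN hΛ hγ' h1 h2 h3

end AbelianAveraging

end

end Literature.MathematicalPhysics.QuantumFieldTheory.Federbush1986
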